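import Mathlib.Tactic.Module
import Mathlib.RingTheory.Coprime.Lemmas
import Literature.AlgebraicGeometry.HodgeTheory.SkewVanishingLatticeTransvectionCalculus
import HarnessLib

/-!
# Skew-symmetric vanishing lattices, II: unimodular transitivity from local pair and square moves

W. Janssen, *Skew-symmetric vanishing lattices and their monodromy groups*, Math. Ann. 266 (1983), §2 (the transitivity
mechanism behind Thm. 2.5 and Thm. 2.9).  Second file of the Literature-side proof of Janssen's Theorem 2.9 (after
`HodgeTheory/SkewVanishingLatticeTransvectionCalculus`).  Setting: an alternating form `B` on a `ℚ`-space `V`, a set `Δ`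
with `B` integral on `Δ`, a subgroup `Γ ≤ (End V)ˣ`, and a unimodular pair `x, y ∈ ℤΔ`, `B(x, y) = 1`, at which `Γ`
contains the LOCAL moves: the level-2 pair moves `v ↦ v + 2(B(v, e)f + B(v, f)e)` for `e, f` in the plane data (`hpair`) and
the square moves `v ↦ v - 2B(v, a)a`, `a ∈ ℤΔ` (`hsq`).

* Part 1 `integral_span`, `pairMove_isometry`, `pairMove_mem_span`, `reach_of_reach_apply`, `intCast_smul_mem` — bookkeeping;
* Part 2 `partner_split` — for `y' ∈ ℤΔ` with `B(t, y') = 1`, the component of `y'` orthogonal to the plane `(x, y)` lies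
  in `ℤΔ`;
* Part 3 `reach_of_one_zero_local`, `reach_of_neg_one_zero_local`, `reach_of_isCoprime_local` — `Γ` moves `x` to every
  `A x + 2β y + 2w` with `A` odd and `(A, β)` reachable in the Euclid game (`euclidGame`, `planeCalculus`);
* Part 4 `reach_of_ne_zero_local` and **`unimodularTransitivity_local`** — `Γ` acts transitively on the unimodular vectors
  `t ∈ x + 2ℤΔ` (those with a partner `y' ∈ ℤΔ`, `B(t, y') = 1`): reduce to `β ≠ 0` by a coprime shift (`coprimeShift`),
  then Euclid.

Theorems only: no definition, no named fact.

Provenance: Literature home (namespace `Literature.AlgebraicGeometry.HodgeTheory.VanishingLattice`; the Summits prefix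
`localTubeSpan_` dropped) of the declarations used by Janssen's Theorem 2.9 from the Summits-side
`HodgeConjecture/Theorems/LinearSystemTorelliLocalTubeSpan{UnimodularTransitivityLemmas, UnimodularTransitivity,
UnimodularTransitivityLocalLemmas, UnimodularTransitivityLocal}` (route `LinearSystemTorelli`, crux `LocalTubeSpan`; imports
Mathlib and `Literature/` only). Lane `lit-hodgefound`, seat p20.

## References

* [Janssen1983] W. A. M. Janssen, *Skew-symmetric vanishing lattices and their monodromy groups*, Math. Ann. 266 (1983)
  115–133, §2.
* [Schnell2010] C. Schnell, *Primitive cohomology and the tube mapping*, Math. Z. 268 (2010), §7.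
-/

noncomputable section

namespace Literature.AlgebraicGeometry.HodgeTheory.VanishingLattice

/-! ## Part 1: Integral spans, pair moves, reach bookkeeping -/

section Part1

-- Sub = Summit), which `linter.dupNamespace` flags on every declaration; the lakefile turns the
-- linter off tree-wide (weak option), restated here so stand-alone elaboration is warning-free too.

open Literature.AlgebraicGeometry.HodgeTheory

variable {V : Type} [AddCommGroup V] [Module ℚ V]

/-! ### Basics: integrality on the lattice, the pair move, the square move -/

section Basics

variable (B : LinearMap.BilinForm ℚ V)

/-- Integrality of `B` on `ℤΔ × ℤΔ` from integrality on `Δ × Δ`. [cite: Janssen1983, §2 (proof of Thm. 2.9)] -/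
theorem integral_span (Δ : Set V) (hint : ∀ δ ∈ Δ, ∀ δ' ∈ Δ, ∃ n : ℤ, B δ δ' = n)
    {u v : V} (hu : u ∈ Submodule.span ℤ Δ) (hv : v ∈ Submodule.span ℤ Δ) :
    ∃ n : ℤ, B u v = n := by
  refine exists_int_eq_of_mem_span_int B Δ v (fun δ hδ => ?_) hu
  obtain ⟨n, hn⟩ := exists_int_eq_of_mem_span_int B.flip Δ δ
    (fun δ' hδ' => by
      obtain ⟨n, hn⟩ := hint δ hδ δ' hδ'
      exact ⟨n, by rw [LinearMap.BilinForm.flip_apply, hn]⟩) hv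
  exact ⟨n, by rw [← hn, LinearMap.BilinForm.flip_apply]⟩

/-- A map acting as the squared transvection pair `x ↦ x + 2(⟨x,e⟩f + ⟨x,f⟩e)` with `⟨e, f⟩ = 0`
is an isometry of the alternating form `B`. [cite: Janssen1983, §2 (proof of Thm. 2.9)] -/
theorem pairMove_isometry (hB : B.IsAlt) {e f : V} (hef : B e f = 0)
    (g : V →ₗ[ℚ] V) (hg : ∀ v, g v = v + (2 : ℚ) • (B v e • f + B v f • e)) (u v : V) :
    B (g u) (g v) = B u v := by
  have hfe : B f e = 0 := by rw [← hB.neg_eq, hef, neg_zero]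
  have hue : B e u = -B u e := (hB.neg_eq u e).symm
  have huf : B f u = -B u f := (hB.neg_eq u f).symm
  have hve : B e v = -B v e := (hB.neg_eq v e).symm
  have hvf : B f v = -B v f := (hB.neg_eq v f).symm
  rw [hg u, hg v]
  simp only [map_add, map_smul, LinearMap.add_apply, LinearMap.smul_apply, smul_eq_mul,
    hB.self_eq_zero, hef, hfe, hve, hvf]
  ring

/-- A map acting as `x ↦ x + 2(⟨x,e⟩f + ⟨x,f⟩e)` with `e, f ∈ ℤΔ` preserves `ℤΔ` (integral `B`).
 [cite: Janssen1983, §2 (proof of Thm. 2.9)] -/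
theorem pairMove_mem_span (Δ : Set V)
    (hint : ∀ δ ∈ Δ, ∀ δ' ∈ Δ, ∃ n : ℤ, B δ δ' = n) {e f : V}
    (he : e ∈ Submodule.span ℤ Δ) (hf : f ∈ Submodule.span ℤ Δ)
    (g : V →ₗ[ℚ] V) (hg : ∀ v, g v = v + (2 : ℚ) • (B v e • f + B v f • e)) {u : V}
    (hu : u ∈ Submodule.span ℤ Δ) : g u ∈ Submodule.span ℤ Δ := by
  obtain ⟨m, hm⟩ := integral_span B Δ hint hu he
  obtain ⟨n, hn⟩ := integral_span B Δ hint hu hf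
  rw [hg u, hm, hn, show (2 : ℚ) • ((m : ℚ) • f + (n : ℚ) • e) = ((2 * m : ℤ) : ℚ) • f +
    ((2 * n : ℤ) : ℚ) • e by push_cast; module, Int.cast_smul_eq_zsmul, Int.cast_smul_eq_zsmul]
  exact Submodule.add_mem _ hu (Submodule.add_mem _ (Submodule.smul_mem _ _ hf)
    (Submodule.smul_mem _ _ he))

end Basics

/-! ### Reachability from `x` by the moves of `Γ` -/

section Reach

variable (B : LinearMap.BilinForm ℚ V) (Δ : Set V)
  (hint : ∀ δ ∈ Δ, ∀ δ' ∈ Δ, ∃ n : ℤ, B δ δ' = n)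
  (Γ : Subgroup (V →ₗ[ℚ] V)ˣ)
  (hpair : ∀ e ∈ Submodule.span ℤ Δ, ∀ f ∈ Submodule.span ℤ Δ, B e f = 0 →
    ∃ g ∈ Γ, ∀ x : V, ((g : (V →ₗ[ℚ] V)ˣ) : V →ₗ[ℚ] V) x = x + (2 : ℚ) • (B x e • f + B x f • e))
  (hsq : ∀ a ∈ Submodule.span ℤ Δ, ∃ g ∈ Γ, ∀ x : V,
    ((g : (V →ₗ[ℚ] V)ˣ) : V →ₗ[ℚ] V) x = x - (2 : ℚ) • (B x a • a))
  {x y : V} (hx : x ∈ Submodule.span ℤ Δ) (hy : y ∈ Submodule.span ℤ Δ) (hxy : B x y = 1)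

/-- Pull back reachability along a move: if `g ∈ Γ` and `g t` is reachable from `x`, so is `t`.
 [cite: Janssen1983, §2 (proof of Thm. 2.9)] -/
theorem reach_of_reach_apply {g : (V →ₗ[ℚ] V)ˣ} (hg : g ∈ Γ) {t : V}
    (h : ∃ g' ∈ Γ, ((g' : (V →ₗ[ℚ] V)ˣ) : V →ₗ[ℚ] V) x = (g : V →ₗ[ℚ] V) t) :
    ∃ g' ∈ Γ, ((g' : (V →ₗ[ℚ] V)ˣ) : V →ₗ[ℚ] V) x = t := by
  obtain ⟨g', hg', hg'x⟩ := h
  refine ⟨g⁻¹ * g', Γ.mul_mem (Γ.inv_mem hg) hg', ?_⟩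
  rw [Units.val_mul, Module.End.mul_apply, hg'x, units_inv_apply_apply]

/-- `((n : ℤ) : ℚ) • v ∈ ℤΔ` for `v ∈ ℤΔ`. [cite: Janssen1983, §2 (proof of Thm. 2.9)] -/
theorem intCast_smul_mem {v : V} (hv : v ∈ Submodule.span ℤ Δ) (n : ℤ) :
    ((n : ℚ)) • v ∈ Submodule.span ℤ Δ := by
  rw [Int.cast_smul_eq_zsmul]
  exact Submodule.smul_mem _ _ hv

end Reach

end Part1

/-! ## Part 2: Splitting a partner -/

section Part2

-- Sub = Summit), which `linter.dupNamespace` flags on every declaration; the lakefile turns the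
-- linter off tree-wide (weak option), restated here so stand-alone elaboration is warning-free too.

open Literature.AlgebraicGeometry.HodgeTheory

variable {V : Type} [AddCommGroup V] [Module ℚ V]

section Reach

variable (B : LinearMap.BilinForm ℚ V) (Δ : Set V)
  (hint : ∀ δ ∈ Δ, ∀ δ' ∈ Δ, ∃ n : ℤ, B δ δ' = n)
  (Γ : Subgroup (V →ₗ[ℚ] V)ˣ)
  (hpair : ∀ e ∈ Submodule.span ℤ Δ, ∀ f ∈ Submodule.span ℤ Δ, B e f = 0 →
    ∃ g ∈ Γ, ∀ x : V, ((g : (V →ₗ[ℚ] V)ˣ) : V →ₗ[ℚ] V) x = x + (2 : ℚ) • (B x e • f + B x f • e))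
  (hsq : ∀ a ∈ Submodule.span ℤ Δ, ∃ g ∈ Γ, ∀ x : V,
    ((g : (V →ₗ[ℚ] V)ˣ) : V →ₗ[ℚ] V) x = x - (2 : ℚ) • (B x a • a))
  {x y : V} (hx : x ∈ Submodule.span ℤ Δ) (hy : y ∈ Submodule.span ℤ Δ) (hxy : B x y = 1)

include hxy in
/-- Splitting a partner: for `y' ∈ ℤΔ` with `⟨t, y'⟩ = 1`, the component
`w₁ = y' - ⟨y',y⟩x + ⟨y',x⟩y` of `y'` orthogonal to the unimodular plane `(x, y)` lies in `ℤΔ` and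
`-⟨y',x⟩⟨t,y⟩ + ⟨y',y⟩⟨t,x⟩ + ⟨t,w₁⟩ = 1`. [cite: Janssen1983, §2 (proof of Thm. 2.9)] -/
theorem partner_split (hB : B.IsAlt)
    (hint : ∀ δ ∈ Δ, ∀ δ' ∈ Δ, ∃ n : ℤ, B δ δ' = n)
    (hx : x ∈ Submodule.span ℤ Δ) (hy : y ∈ Submodule.span ℤ Δ)
    {t y' : V} (hy' : y' ∈ Submodule.span ℤ Δ) (hty' : B t y' = 1) :
    ∃ w₁ ∈ Submodule.span ℤ Δ, B w₁ x = 0 ∧ B w₁ y = 0 ∧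
      -(B y' x) * B t y + (B y' y) * B t x + B t w₁ = 1 := by
  have hyx : B y x = -1 := by rw [← hB.neg_eq, hxy]
  obtain ⟨u, hu⟩ := integral_span B Δ hint hy' hx
  obtain ⟨w, hw⟩ := integral_span B Δ hint hy' hy
  refine ⟨y' - (B y' y) • x + (B y' x) • y, ?_, ?_, ?_, ?_⟩
  · rw [hu, hw]
    exact Submodule.add_mem _ (Submodule.sub_mem _ hy' (intCast_smul_mem Δ hx _))
      (intCast_smul_mem Δ hy _)
  · rw [map_add, map_sub, map_smul, map_smul, LinearMap.add_apply, LinearMap.sub_apply,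
      LinearMap.smul_apply, LinearMap.smul_apply, hB.self_eq_zero, hyx, smul_eq_mul, smul_eq_mul]
    ring
  · rw [map_add, map_sub, map_smul, map_smul, LinearMap.add_apply, LinearMap.sub_apply,
      LinearMap.smul_apply, LinearMap.smul_apply, hB.self_eq_zero, hxy, smul_eq_mul, smul_eq_mul]
    ring
  · rw [map_add, map_sub, map_smul, map_smul, hty']
    ring

end Reach

/-! ### The theorem -/

end Part2

/-! ## Part 3: Reaching `(1,0)`, `(-1,0)` and coprime pairs locally -/

section Part3

-- Sub = Summit), which `linter.dupNamespace` flags on every declaration; the lakefile turns the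
-- linter off tree-wide (weak option), restated here so stand-alone elaboration is warning-free too.

open Literature.AlgebraicGeometry.HodgeTheory

variable {V : Type} [AddCommGroup V] [Module ℚ V]

/-! ### Reachability from `x` by the local moves of `Γ` -/

section ReachLocal

variable (B : LinearMap.BilinForm ℚ V) (Δ : Set V) (Γ : Subgroup (V →ₗ[ℚ] V)ˣ) {x y : V}

/-- The pair `(A, β) = (1, 0)`: `t = x + 2z` with `⟨t, y⟩ = 1`, `⟨t, x⟩ = 0` is `E_{y,z}² x` (pair
move at `e = y`). [cite: Janssen1983, §2 (proof of Thm. 2.9)] -/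
theorem reach_of_one_zero_local (hB : B.IsAlt) (hxy : B x y = 1)
    (hpair : ∀ e ∈ ({x, y} : Set V), ∀ f ∈ Submodule.span ℤ Δ, B e f = 0 →
      ∃ g ∈ Γ, ∀ v : V, ((g : (V →ₗ[ℚ] V)ˣ) : V →ₗ[ℚ] V) v = v + (2 : ℚ) • (B v e • f + B v f • e))
    {t z : V} (hz : z ∈ Submodule.span ℤ Δ)
    (ht : t = x + (2 : ℚ) • z) (hty : B t y = 1) (htx : B t x = 0) :
    ∃ g ∈ Γ, ((g : (V →ₗ[ℚ] V)ˣ) : V →ₗ[ℚ] V) x = t := by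
  have hzy : B z y = 0 := by
    have h := hty
    rw [ht, map_add, map_smul, LinearMap.add_apply, LinearMap.smul_apply, hxy, smul_eq_mul] at h
    linarith
  have hzx : B z x = 0 := by
    have h := htx
    rw [ht, map_add, map_smul, LinearMap.add_apply, LinearMap.smul_apply, hB.self_eq_zero,
      smul_eq_mul] at h
    linarith
  have hyz : B y z = 0 := by rw [← hB.neg_eq, hzy, neg_zero]
  have hxz : B x z = 0 := by rw [← hB.neg_eq, hzx, neg_zero]
  obtain ⟨g, hg, hgf⟩ := hpair y (by simp) z hz hyz
  refine ⟨g, hg, ?_⟩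
  rw [hgf, hxy, hxz, ht]
  module

/-- The pair `(A, β) = (-1, 0)`: the word `T_x² T_y² T_{x+y}²` (square moves at `x`, `y`, `x + y`)
acts as `-1` on the plane and moves `t` to `t + 2x`, which has the pair `(1, 0)`. [cite: Janssen1983, §2 (proof of Thm. 2.9)] -/
theorem reach_of_neg_one_zero_local (hB : B.IsAlt) (hxy : B x y = 1)
    (hpair : ∀ e ∈ ({x, y} : Set V), ∀ f ∈ Submodule.span ℤ Δ, B e f = 0 →
      ∃ g ∈ Γ, ∀ v : V, ((g : (V →ₗ[ℚ] V)ˣ) : V →ₗ[ℚ] V) v = v + (2 : ℚ) • (B v e • f + B v f • e))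
    (hsq : ∀ a ∈ ({x, y, x + y} : Set V), ∃ g ∈ Γ, ∀ v : V,
      ((g : (V →ₗ[ℚ] V)ˣ) : V →ₗ[ℚ] V) v = v - (2 : ℚ) • (B v a • a))
    (hx : x ∈ Submodule.span ℤ Δ) {t z : V} (hz : z ∈ Submodule.span ℤ Δ)
    (ht : t = x + (2 : ℚ) • z) (hty : B t y = -1) (htx : B t x = 0) :
    ∃ g ∈ Γ, ((g : (V →ₗ[ℚ] V)ˣ) : V →ₗ[ℚ] V) x = t := by
  obtain ⟨gx, hgx, hgxf⟩ := hsq x (by simp)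
  obtain ⟨gy, hgy, hgyf⟩ := hsq y (by simp)
  obtain ⟨gxy, hgxy, hgxyf⟩ := hsq (x + y) (by simp)
  -- the word acts as `v ↦ v - 2(⟨v,y⟩x - ⟨v,x⟩y)`
  have hword : ∀ v, ((gx * gy * gxy : (V →ₗ[ℚ] V)ˣ) : V →ₗ[ℚ] V) v =
      v - (2 : ℚ) • (B v y • x - B v x • y) := by
    intro v
    rw [Units.val_mul, Units.val_mul, Module.End.mul_apply, Module.End.mul_apply, hgxyf, hgyf,
      hgxf, ← skewTransvection_sq_apply B hB (x + y) v,
      ← skewTransvection_sq_apply B hB y,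
      ← skewTransvection_sq_apply B hB x]
    exact (planeCalculus B hB).1 x y hxy v
  have hg0 : gx * gy * gxy ∈ Γ := Γ.mul_mem (Γ.mul_mem hgx hgy) hgxy
  refine reach_of_reach_apply Γ hg0 ?_
  refine reach_of_one_zero_local B Δ Γ hB hxy hpair (z := z + x)
    (Submodule.add_mem _ hz hx) ?_ ?_ ?_
  · rw [hword, hty, htx, ht]; module
  · rw [hword, hty, htx, map_sub, map_smul, LinearMap.sub_apply, LinearMap.smul_apply, hty,
      map_sub, map_smul, map_smul, LinearMap.sub_apply, LinearMap.smul_apply,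
      LinearMap.smul_apply, hxy, hB.self_eq_zero]
    norm_num
  · rw [hword, hty, htx, map_sub, map_smul, LinearMap.sub_apply, LinearMap.smul_apply, htx,
      map_sub, map_smul, map_smul, LinearMap.sub_apply, LinearMap.smul_apply,
      LinearMap.smul_apply, hB.self_eq_zero, show B y x = -1 by rw [← hB.neg_eq, hxy]]
    norm_num

/-- The COPRIME case: `t = x + 2z` with `(⟨t, y⟩, ⟨z, x⟩) = (A, β)` coprime is reachable — the Euclid
game on `(A, β)` played with powers of the square moves `T_y²` (`β ↦ β ∓ kA`) and `T_x²`
(`A ↦ A ∓ 4kβ`) down to `(±1, 0)`. [cite: Janssen1983, §2 (proof of Thm. 2.9)] -/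
theorem reach_of_isCoprime_local (hB : B.IsAlt)
    (hint : ∀ δ ∈ Δ, ∀ δ' ∈ Δ, ∃ n : ℤ, B δ δ' = n) (hxy : B x y = 1)
    (hpair : ∀ e ∈ ({x, y} : Set V), ∀ f ∈ Submodule.span ℤ Δ, B e f = 0 →
      ∃ g ∈ Γ, ∀ v : V, ((g : (V →ₗ[ℚ] V)ˣ) : V →ₗ[ℚ] V) v = v + (2 : ℚ) • (B v e • f + B v f • e))
    (hsq : ∀ a ∈ ({x, y, x + y} : Set V), ∃ g ∈ Γ, ∀ v : V,
      ((g : (V →ₗ[ℚ] V)ˣ) : V →ₗ[ℚ] V) v = v - (2 : ℚ) • (B v a • a))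
    (hx : x ∈ Submodule.span ℤ Δ) (hy : y ∈ Submodule.span ℤ Δ)
    {t z : V} (hz : z ∈ Submodule.span ℤ Δ) (ht : t = x + (2 : ℚ) • z)
    {A β : ℤ} (htA : B t y = A) (hzβ : B z x = β) (hcop : IsCoprime A β) :
    ∃ g ∈ Γ, ((g : (V →ₗ[ℚ] V)ˣ) : V →ₗ[ℚ] V) x = t := by
  have hyx : B y x = -1 := by rw [← hB.neg_eq, hxy]
  -- `A` is odd
  have hAodd : Odd A := by
    obtain ⟨n, hn⟩ := integral_span B Δ hint hz hy
    have h : (A : ℚ) = 2 * n + 1 := by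
      rw [← htA, ht, map_add, map_smul, LinearMap.add_apply, LinearMap.smul_apply, hxy, hn,
        smul_eq_mul]
      ring
    exact ⟨n, by exact_mod_cast h⟩
  obtain ⟨gx, hgx, hgxf⟩ := hsq x (by simp)
  obtain ⟨gy, hgy, hgyf⟩ := hsq y (by simp)
  have hPx := (planeCalculus B hB).2 x gx hgxf
  have hPy := (planeCalculus B hB).2 y gy hgyf
  refine euclidGame
    (fun A β => ∀ t z : V, z ∈ Submodule.span ℤ Δ → t = x + (2 : ℚ) • z → B t y = A →
      B z x = β → ∃ g ∈ Γ, ((g : (V →ₗ[ℚ] V)ˣ) : V →ₗ[ℚ] V) x = t)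
    ?_ ?_ ?_ ?_ A β hAodd hcop t z hz ht htA hzβ
  · -- `β ↦ β + kA` by powers of `T_y²`
    intro A β k hP t z hz ht htA hzβ
    rcases Int.eq_nat_or_neg k with ⟨m, rfl | rfl⟩
    · -- `k = m`: apply `(T_y²)^{-m}`, which adds `2mA y`
      refine reach_of_reach_apply Γ (Γ.pow_mem (Γ.inv_mem hgy) m) ?_
      refine hP _ (z + (((m : ℤ) * A : ℤ) : ℚ) • y)
        (Submodule.add_mem _ hz (intCast_smul_mem Δ hy _)) ?_ ?_ ?_
      · rw [(hPy m t).2, htA, ht]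
        push_cast
        module
      · rw [(hPy m t).2, htA, map_add, map_smul, LinearMap.add_apply, LinearMap.smul_apply, htA,
          map_smul, LinearMap.smul_apply, hB.self_eq_zero, smul_eq_mul, smul_eq_mul, mul_zero,
          mul_zero, add_zero]
      · rw [map_add, map_smul, LinearMap.add_apply, LinearMap.smul_apply, hzβ, hyx, smul_eq_mul]
        push_cast
        ring
    · -- `k = -m`: apply `(T_y²)^{m}`, which subtracts `2mA y`
      refine reach_of_reach_apply Γ (Γ.pow_mem hgy m) ?_
      refine hP _ (z - (((m : ℤ) * A : ℤ) : ℚ) • y)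
        (Submodule.sub_mem _ hz (intCast_smul_mem Δ hy _)) ?_ ?_ ?_
      · rw [(hPy m t).1, htA, ht]
        push_cast
        module
      · rw [(hPy m t).1, htA, map_sub, map_smul, LinearMap.sub_apply, LinearMap.smul_apply, htA,
          map_smul, LinearMap.smul_apply, hB.self_eq_zero, smul_eq_mul, smul_eq_mul, mul_zero,
          mul_zero, sub_zero]
      · rw [map_sub, map_smul, LinearMap.sub_apply, LinearMap.smul_apply, hzβ, hyx, smul_eq_mul]
        push_cast
        ring
  · -- `A ↦ A + 4kβ` by powers of `T_x²`
    intro A β k hP t z hz ht htA hzβ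
    have htx : B t x = 2 * β := by
      rw [ht, map_add, map_smul, LinearMap.add_apply, LinearMap.smul_apply, hB.self_eq_zero, hzβ,
        smul_eq_mul, zero_add]
    rcases Int.eq_nat_or_neg k with ⟨m, rfl | rfl⟩
    · -- `k = m`: apply `(T_x²)^{m}`, which subtracts `4mβ x`
      refine reach_of_reach_apply Γ (Γ.pow_mem hgx m) ?_
      refine hP _ (z - ((2 * (m : ℤ) * β : ℤ) : ℚ) • x)
        (Submodule.sub_mem _ hz (intCast_smul_mem Δ hx _)) ?_ ?_ ?_
      · rw [(hPx m t).1, htx, ht]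
        push_cast
        module
      · rw [(hPx m t).1, htx, map_sub, map_smul, LinearMap.sub_apply, LinearMap.smul_apply, htA,
          map_smul, LinearMap.smul_apply, hxy, smul_eq_mul, smul_eq_mul]
        push_cast
        ring
      · rw [map_sub, map_smul, LinearMap.sub_apply, LinearMap.smul_apply, hzβ, hB.self_eq_zero,
          smul_eq_mul, mul_zero, sub_zero]
    · -- `k = -m`: apply `(T_x²)^{-m}`, which adds `4mβ x`
      refine reach_of_reach_apply Γ (Γ.pow_mem (Γ.inv_mem hgx) m) ?_
      refine hP _ (z + ((2 * (m : ℤ) * β : ℤ) : ℚ) • x)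
        (Submodule.add_mem _ hz (intCast_smul_mem Δ hx _)) ?_ ?_ ?_
      · rw [(hPx m t).2, htx, ht]
        push_cast
        module
      · rw [(hPx m t).2, htx, map_add, map_smul, LinearMap.add_apply, LinearMap.smul_apply, htA,
          map_smul, LinearMap.smul_apply, hxy, smul_eq_mul, smul_eq_mul]
        push_cast
        ring
      · rw [map_add, map_smul, LinearMap.add_apply, LinearMap.smul_apply, hzβ, hB.self_eq_zero,
          smul_eq_mul, mul_zero, add_zero]
  · -- base `(1, 0)`
    intro t z hz ht htA hzβ
    refine reach_of_one_zero_local B Δ Γ hB hxy hpair hz ht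
      (by rw [htA, Int.cast_one]) ?_
    rw [ht, map_add, map_smul, LinearMap.add_apply, LinearMap.smul_apply, hB.self_eq_zero, hzβ,
      Int.cast_zero, smul_zero, add_zero]
  · -- base `(-1, 0)`
    intro t z hz ht htA hzβ
    refine reach_of_neg_one_zero_local B Δ Γ hB hxy hpair hsq hx hz ht
      (by rw [htA, Int.cast_neg, Int.cast_one]) ?_
    rw [ht, map_add, map_smul, LinearMap.add_apply, LinearMap.smul_apply, hB.self_eq_zero, hzβ,
      Int.cast_zero, smul_zero, add_zero]

end ReachLocal

end Part3

/-! ## Part 4: Unimodular transitivity from local pair/square moves -/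

section Part4

-- Sub = Summit), which `linter.dupNamespace` flags on every declaration; the lakefile turns the
-- linter off tree-wide (weak option), restated here so stand-alone elaboration is warning-free too.

open Literature.AlgebraicGeometry.HodgeTheory

variable {V : Type} [AddCommGroup V] [Module ℚ V]

section ReachLocal

variable (B : LinearMap.BilinForm ℚ V) (Δ : Set V) (Γ : Subgroup (V →ₗ[ℚ] V)ˣ) {x y : V}

/-- The case `β = ⟨z, x⟩ ≠ 0`: a unimodular `t = x + 2z` is reachable — break the common factor of
`(A, β)` by the pair move `E_{x, s w₁}²: A ↦ A + 2s⟨t, w₁⟩` at `e = x` (`s` from the coprime shift),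
then the coprime case. [cite: Janssen1983, §2 (proof of Thm. 2.9)] -/
theorem reach_of_ne_zero_local (hB : B.IsAlt)
    (hint : ∀ δ ∈ Δ, ∀ δ' ∈ Δ, ∃ n : ℤ, B δ δ' = n) (hxy : B x y = 1)
    (hpair : ∀ e ∈ ({x, y} : Set V), ∀ f ∈ Submodule.span ℤ Δ, B e f = 0 →
      ∃ g ∈ Γ, ∀ v : V, ((g : (V →ₗ[ℚ] V)ˣ) : V →ₗ[ℚ] V) v = v + (2 : ℚ) • (B v e • f + B v f • e))
    (hsq : ∀ a ∈ ({x, y, x + y} : Set V), ∃ g ∈ Γ, ∀ v : V,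
      ((g : (V →ₗ[ℚ] V)ˣ) : V →ₗ[ℚ] V) v = v - (2 : ℚ) • (B v a • a))
    (hx : x ∈ Submodule.span ℤ Δ) (hy : y ∈ Submodule.span ℤ Δ)
    {t z : V} (hz : z ∈ Submodule.span ℤ Δ) (ht : t = x + (2 : ℚ) • z)
    {A β : ℤ} (htA : B t y = A) (hzβ : B z x = β) (hβ0 : β ≠ 0)
    (htu : ∃ y' ∈ Submodule.span ℤ Δ, B t y' = 1) :
    ∃ g ∈ Γ, ((g : (V →ₗ[ℚ] V)ˣ) : V →ₗ[ℚ] V) x = t := by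
  obtain ⟨y', hy', hty'⟩ := htu
  obtain ⟨w₁, hw₁, hw₁x, hw₁y, hrel⟩ := partner_split B Δ hxy hB hint hx hy hy' hty'
  have htmem : t ∈ Submodule.span ℤ Δ := by
    rw [ht, show (2 : ℚ) • z = ((2 : ℤ) : ℚ) • z by norm_num]
    exact Submodule.add_mem _ hx (intCast_smul_mem Δ hz _)
  have htx : B t x = 2 * β := by
    rw [ht, map_add, map_smul, LinearMap.add_apply, LinearMap.smul_apply, hB.self_eq_zero, hzβ,
      smul_eq_mul, zero_add]
  obtain ⟨u, hu⟩ := integral_span B Δ hint hy' hx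
  obtain ⟨w, hw⟩ := integral_span B Δ hint hy' hy
  obtain ⟨j, hj⟩ := integral_span B Δ hint htmem hw₁
  -- the arithmetic relation `(-u) A + 2 w β + j = 1`
  have hrelZ : -u * A + 2 * w * β + j = 1 := by
    rw [hu, hw, htA, htx, hj] at hrel
    exact_mod_cast (show -(u : ℚ) * A + 2 * w * β + j = 1 by rw [← hrel]; ring)
  -- `A` is odd
  have hAodd : Odd A := by
    obtain ⟨n, hn⟩ := integral_span B Δ hint hz hy
    have h : (A : ℚ) = 2 * n + 1 := by
      rw [← htA, ht, map_add, map_smul, LinearMap.add_apply, LinearMap.smul_apply, hxy, hn,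
        smul_eq_mul]
      ring
    exact ⟨n, by exact_mod_cast h⟩
  by_cases hj0 : j = 0
  · -- `j = 0`: `(A, β)` is already coprime
    refine reach_of_isCoprime_local B Δ Γ hB hint hxy hpair hsq hx hy hz ht htA hzβ
      ⟨-u, 2 * w, ?_⟩
    rw [hj0] at hrelZ
    linarith
  · obtain ⟨s, hs⟩ := coprimeShift A β j (-u) w hAodd hrelZ hβ0 hj0
    have hsw₁ : (s : ℚ) • w₁ ∈ Submodule.span ℤ Δ := intCast_smul_mem Δ hw₁ s
    have hxsw₁ : B x ((s : ℚ) • w₁) = 0 := by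
      rw [map_smul, smul_eq_mul, ← hB.neg_eq, hw₁x, neg_zero, mul_zero]
    obtain ⟨g, hg, hgf⟩ := hpair x (by simp) _ hsw₁ hxsw₁
    refine reach_of_reach_apply Γ hg ?_
    have htw₁ : B t ((s : ℚ) • w₁) = s * j := by rw [map_smul, smul_eq_mul, hj]
    refine reach_of_isCoprime_local B Δ Γ hB hint hxy hpair hsq hx hy
      (z := z + ((2 * β * s : ℤ) : ℚ) • w₁ + ((s * j : ℤ) : ℚ) • x)
      (Submodule.add_mem _ (Submodule.add_mem _ hz (intCast_smul_mem Δ hw₁ _))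
        (intCast_smul_mem Δ hx _)) ?_ (A := A + s * (2 * j)) (β := β) ?_ ?_ hs
    · rw [hgf, htx, htw₁, ht]
      push_cast
      module
    · rw [hgf, htx, htw₁]
      simp only [map_add, map_smul, LinearMap.add_apply, LinearMap.smul_apply, smul_eq_mul, htA,
        hxy, hw₁y]
      push_cast
      ring
    · rw [map_add, map_add, map_smul, map_smul, LinearMap.add_apply, LinearMap.add_apply,
        LinearMap.smul_apply, LinearMap.smul_apply, hzβ, hw₁x, hB.self_eq_zero, smul_eq_mul,
        smul_eq_mul, mul_zero, mul_zero, add_zero, add_zero]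

end ReachLocal

/-! ### The theorem -/

/-- **Unimodular transitivity of the level-2 elementary moves, local hypotheses.**  Let `ℤΔ` be a
lattice on which the alternating form `B` is integral and `x, y ∈ ℤΔ` with `⟨x, y⟩ = 1`, and let
`Γ ≤ GL(V)` contain a move `v ↦ v + 2(⟨v,e⟩f + ⟨v,f⟩e)` for `e ∈ {x, y}` and all `f ∈ ℤΔ` with
`⟨e, f⟩ = 0`, and a move `T_a² : v ↦ v - 2⟨v,a⟩a` for `a ∈ {x, y, x + y}` (for a base pair of a skew
vanishing lattice these lie in the monodromy group `Γ_Δ` without Janssen's Theorem 2.5).  Then every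
`t ∈ x + 2ℤΔ` which is unimodular (`⟨t, y'⟩ = 1` for some `y' ∈ ℤΔ`) is `g x` for some `g ∈ Γ`.
Proof: coordinates `A = ⟨t, y⟩` (odd), `β = ⟨z, x⟩`; if `β ≠ 0`, `reach_of_ne_zero_local`;
if `β = 0` and `A = ±1`, the coprime case; otherwise one move `E_{y,w₁}²` makes `β = -⟨t, w₁⟩ ≠ 0`
(unimodularity is transported along the isometry).
[cite: Janssen1983, Thm. 2.9 (proof from Thm. 2.5)] -/
theorem unimodularTransitivity_local (B : LinearMap.BilinForm ℚ V) (hB : B.IsAlt)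
    (Δ : Set V) (hint : ∀ δ ∈ Δ, ∀ δ' ∈ Δ, ∃ n : ℤ, B δ δ' = n)
    (Γ : Subgroup (V →ₗ[ℚ] V)ˣ) {x y : V} (hx : x ∈ Submodule.span ℤ Δ)
    (hy : y ∈ Submodule.span ℤ Δ) (hxy : B x y = 1)
    (hpair : ∀ e ∈ ({x, y} : Set V), ∀ f ∈ Submodule.span ℤ Δ, B e f = 0 →
      ∃ g ∈ Γ, ∀ v : V, ((g : (V →ₗ[ℚ] V)ˣ) : V →ₗ[ℚ] V) v = v + (2 : ℚ) • (B v e • f + B v f • e))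
    (hsq : ∀ a ∈ ({x, y, x + y} : Set V), ∃ g ∈ Γ, ∀ v : V,
        ((g : (V →ₗ[ℚ] V)ˣ) : V →ₗ[ℚ] V) v = v - (2 : ℚ) • (B v a • a))
    {t : V} (ht : ∃ z ∈ Submodule.span ℤ Δ, t = x + (2 : ℚ) • z)
    (htu : ∃ y' ∈ Submodule.span ℤ Δ, B t y' = 1) :
    ∃ g ∈ Γ, ((g : (V →ₗ[ℚ] V)ˣ) : V →ₗ[ℚ] V) x = t := by
  obtain ⟨z, hz, ht⟩ := ht
  have hyx : B y x = -1 := by rw [← hB.neg_eq, hxy]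
  have htmem : t ∈ Submodule.span ℤ Δ := by
    rw [ht, show (2 : ℚ) • z = ((2 : ℤ) : ℚ) • z by norm_num]
    exact Submodule.add_mem _ hx (intCast_smul_mem Δ hz _)
  obtain ⟨A, htA⟩ := integral_span B Δ hint htmem hy
  obtain ⟨β, hzβ⟩ := integral_span B Δ hint hz hx
  by_cases hβ0 : β = 0
  swap
  · exact reach_of_ne_zero_local B Δ Γ hB hint hxy hpair hsq hx hy hz ht htA hzβ hβ0
      htu
  subst hβ0
  by_cases hunit : IsUnit A
  · exact reach_of_isCoprime_local B Δ Γ hB hint hxy hpair hsq hx hy hz ht htA hzβ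
      (isCoprime_zero_right.2 hunit)
  -- `β = 0`, `A ≠ ±1`: make `β ≠ 0` by one move `E_{y, w₁}²`
  obtain ⟨y', hy', hty'⟩ := htu
  obtain ⟨w₁, hw₁, hw₁x, hw₁y, hrel⟩ := partner_split B Δ hxy hB hint hx hy hy' hty'
  have htx : B t x = 0 := by
    rw [ht, map_add, map_smul, LinearMap.add_apply, LinearMap.smul_apply, hB.self_eq_zero, hzβ,
      Int.cast_zero, smul_zero, add_zero]
  obtain ⟨u, hu⟩ := integral_span B Δ hint hy' hx
  obtain ⟨j, hj⟩ := integral_span B Δ hint htmem hw₁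
  have hj0 : j ≠ 0 := by
    rintro rfl
    rw [hu, htA, htx, hj, Int.cast_zero, mul_zero, add_zero, add_zero] at hrel
    exact hunit (IsUnit.of_mul_eq_one (-u) (by exact_mod_cast (show (A : ℚ) * -u = 1 by
      rw [← hrel]; ring)))
  have hyw₁ : B y w₁ = 0 := by rw [← hB.neg_eq, hw₁y, neg_zero]
  obtain ⟨g, hg, hgf⟩ := hpair y (by simp) w₁ hw₁ hyw₁
  refine reach_of_reach_apply Γ hg ?_
  refine reach_of_ne_zero_local B Δ Γ hB hint hxy hpair hsq hx hy
    (z := z + (A : ℚ) • w₁ + (j : ℚ) • y)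
    (Submodule.add_mem _ (Submodule.add_mem _ hz (intCast_smul_mem Δ hw₁ _))
      (intCast_smul_mem Δ hy _)) ?_ (A := A) (β := -j) ?_ ?_ (neg_ne_zero.2 hj0) ?_
  · rw [hgf, htA, hj, ht]
    module
  · rw [hgf, htA, hj, map_add, map_smul, map_add, map_smul, map_smul, LinearMap.add_apply,
      LinearMap.smul_apply, LinearMap.add_apply, LinearMap.smul_apply, LinearMap.smul_apply, htA,
      hw₁y, hB.self_eq_zero, smul_eq_mul, smul_eq_mul, smul_eq_mul, mul_zero, mul_zero, add_zero,
      mul_zero, add_zero]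
  · simp only [map_add, map_smul, LinearMap.add_apply, LinearMap.smul_apply, hzβ, hw₁x, hyx,
      smul_eq_mul, Int.cast_zero, Int.cast_neg]
    ring
  · -- unimodularity is transported along the isometry `g`
    refine ⟨(g : V →ₗ[ℚ] V) y', pairMove_mem_span B Δ hint hy hw₁ _ hgf hy', ?_⟩
    rw [pairMove_isometry B hB hyw₁ _ hgf, hty']

end Part4

end Literature.AlgebraicGeometry.HodgeTheory.VanishingLattice

end
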